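import Summits.Ventures.PercRepro.SixFourResidueThreeGenericAll

/-!
# PercRepro — C-025 at `(6,4)`: the per-pair inequality of Theorem G₃ as an integer table, `11 ≤ g ≤ 100` (p2, gen 9)

`PerPair3 g p m` (`SixFourResidueThreeGenericAll.lean`) is a rational inequality with denominators `5`, `2`, `g − m`,
`C(g,2)`; multiplied by `10·(g − m)·C(g,2) > 0` it is the integer inequality `PerPairN g p m`
(`perPair3_of_perPairN`).  `perPairCheck g` decides it on every `3 ≤ p ≤ g − 3`, `2 ≤ m < p`; the checks for
`11 ≤ g ≤ 100` are here (mine-2's `j3tail_crude`: the minimum of `T₃/base₃` is `0.0105` at `(g, p) = (11, 8)`, rising with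
`g`; at `g = 10` the single failure `(p, m) = (7, 2)` is `U_{3,7}`, §21.16's remark), giving Theorem G₃ for
`11 ≤ g ≤ 100` (`J_three_nonneg_of_generic_of_table`); `g ≥ 101` is §21.16's two-regime tail (open).
-/

namespace PercRepro.SixFour

/-! ## The integer form -/

/-- `10·F₃(g)` as an integer: `18(2^g − S₃(g)) + 12·S₂(g) − 24·C(g,4)`. -/
def F3N (g : ℕ) : ℤ := 18 * (2 ^ g : ℤ) - 18 * (S3 g : ℤ) + 12 * (S2 g : ℤ) - 24 * (g.choose 4 : ℤ)

/-- `10·bonus₃(m)`. -/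
def bonus3N (m : ℕ) : ℤ := 12 * (eps m : ℤ) - 18 * (delta m : ℤ) + 24 * (m.choose 4 : ℤ)

/-- `10·(9/5 + (3/2)(g − p)) = 18 + 15(g − p)`. -/
def KN (g p : ℕ) : ℤ := 18 + 15 * ((g : ℤ) - p)

/-- `10·(g − m)·C(g,2)·L₃(g,p,m)`. -/
def LtermN (g p m : ℕ) : ℤ :=
  ((p - m : ℕ) : ℤ) * (F3N g * (m.choose 2 : ℤ) + (g.choose 2 : ℤ) * (bonus3N m + 10 * (eps m : ℤ) * ((g - m).choose 2 : ℤ))) +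
    (g.choose 2 : ℤ) * ((g - m : ℕ) : ℤ) * (KN g p * (delta m : ℤ) - 24 * (m.choose 4 : ℤ) - 10 * (eps m : ℤ) * ((p - m).choose 2 : ℤ))

/-- `10·base₃(g,p)`. -/
def base3N (g p : ℕ) : ℤ := KN g p * (delta p : ℤ) - 24 * (p.choose 4 : ℤ)

/-- The per-pair inequality in `ℤ`: `C(m,2)·base₃N·(g − m)·C(g,2) ≤ C(p,2)·L₃N`. -/
def PerPairN (g p m : ℕ) : Prop :=
  (m.choose 2 : ℤ) * base3N g p * ((g - m : ℕ) : ℤ) * (g.choose 2 : ℤ) ≤ (p.choose 2 : ℤ) * LtermN g p m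

/-- `PerPairN` is decidable. -/
instance (g p m : ℕ) : Decidable (PerPairN g p m) := by unfold PerPairN; infer_instance

/-- `10·F₃(g) = F3N g` in `ℚ`. -/
theorem F3N_eq (g : ℕ) : (F3N g : ℚ) = 10 * F3 g := by
  unfold F3N F3
  push_cast
  ring

/-- `10·bonus₃(m) = bonus3N m` in `ℚ`. -/
theorem bonus3N_eq (m : ℕ) : (bonus3N m : ℚ) = 10 * bonus3 m := by
  unfold bonus3N bonus3
  push_cast
  ring

/-- `10·(g − m)·C(g,2)·L₃(g,p,m) = LtermN g p m` for `m < g`, `2 ≤ g`. -/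
theorem LtermN_eq {g p m : ℕ} (hm : m < g) (hg : 2 ≤ g) :
    (LtermN g p m : ℚ) = 10 * ((g - m : ℕ) : ℚ) * (g.choose 2 : ℚ) * Lterm3 g p m := by
  have hD : ((g - m : ℕ) : ℚ) ≠ 0 := by
    have : 0 < g - m := by omega
    positivity
  have hC : (g.choose 2 : ℚ) ≠ 0 := by
    have : 0 < g.choose 2 := Nat.choose_pos hg
    positivity
  have hy := price_identity3 (g := g) (m := m) hm
  have hF := F3_eq_yP3 (g := g) hg
  unfold LtermN KN
  push_cast
  rw [F3N_eq, bonus3N_eq, hF]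
  unfold Lterm3
  -- eliminate `yPrice3` through the price identity
  have hy' : yPrice3 g m = (yP3 g * (m.choose 2 : ℚ) + bonus3 m + (eps m : ℚ) * ((g - m).choose 2 : ℚ)) / ((g - m : ℕ) : ℚ) := by
    rw [eq_div_iff hD]
    exact hy
  rw [hy']
  field_simp
  ring

/-- **Transfer**: the integer inequality gives the rational one. -/
theorem perPair3_of_perPairN {g p m : ℕ} (hm : m < g) (hg : 2 ≤ g) (h : PerPairN g p m) : PerPair3 g p m := by
  unfold PerPairN at h
  unfold PerPair3
  have hD : (0 : ℚ) < ((g - m : ℕ) : ℚ) := by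
    have : 0 < g - m := by omega
    exact_mod_cast this
  have hC : (0 : ℚ) < (g.choose 2 : ℚ) := by
    have : 0 < g.choose 2 := Nat.choose_pos hg
    exact_mod_cast this
  have hQ : ((m.choose 2 : ℤ) * base3N g p * ((g - m : ℕ) : ℤ) * (g.choose 2 : ℤ) : ℚ) ≤
      ((p.choose 2 : ℤ) * LtermN g p m : ℚ) := by exact_mod_cast h
  push_cast at hQ
  rw [LtermN_eq hm hg] at hQ
  have hB : (base3N g p : ℚ) = 10 * base3 g p := by
    unfold base3N base3 KN
    push_cast
    ring
  rw [hB] at hQ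
  have hpos : (0 : ℚ) < 10 * ((g - m : ℕ) : ℚ) * (g.choose 2 : ℚ) := by positivity
  nlinarith [hQ, hpos]

/-! ## The finite checks -/

/-- The check at a fixed `g`: `PerPairN g p m` for every `3 ≤ p ≤ g − 3`, `2 ≤ m < p`. -/
def perPairCheck (g : ℕ) : Prop := ∀ p < g, ∀ m < p, (!decide (3 ≤ p ∧ p + 3 ≤ g ∧ 2 ≤ m) || decide (PerPairN g p m)) = true

/-- The per-pair check at `g = 11` (`decide`). -/
theorem perPairCheck_11 : perPairCheck 11 := by unfold perPairCheck; decide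
/-- The per-pair check at `g = 12` (`decide`). -/
theorem perPairCheck_12 : perPairCheck 12 := by unfold perPairCheck; decide
/-- The per-pair check at `g = 13` (`decide`). -/
theorem perPairCheck_13 : perPairCheck 13 := by unfold perPairCheck; decide
/-- The per-pair check at `g = 14` (`decide`). -/
theorem perPairCheck_14 : perPairCheck 14 := by unfold perPairCheck; decide
/-- The per-pair check at `g = 15` (`decide`). -/
theorem perPairCheck_15 : perPairCheck 15 := by unfold perPairCheck; decide
/-- The per-pair check at `g = 16` (`decide`). -/
theorem perPairCheck_16 : perPairCheck 16 := by unfold perPairCheck; decide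
/-- The per-pair check at `g = 17` (`decide`). -/
theorem perPairCheck_17 : perPairCheck 17 := by unfold perPairCheck; decide
/-- The per-pair check at `g = 18` (`decide`). -/
theorem perPairCheck_18 : perPairCheck 18 := by unfold perPairCheck; decide
/-- The per-pair check at `g = 19` (`decide`). -/
theorem perPairCheck_19 : perPairCheck 19 := by unfold perPairCheck; decide
/-- The per-pair check at `g = 20` (`decide`). -/
theorem perPairCheck_20 : perPairCheck 20 := by unfold perPairCheck; decide
/-- The per-pair check at `g = 21` (`decide`). -/
theorem perPairCheck_21 : perPairCheck 21 := by unfold perPairCheck; decide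
/-- The per-pair check at `g = 22` (`decide`). -/
theorem perPairCheck_22 : perPairCheck 22 := by unfold perPairCheck; decide
/-- The per-pair check at `g = 23` (`decide`). -/
theorem perPairCheck_23 : perPairCheck 23 := by unfold perPairCheck; decide
/-- The per-pair check at `g = 24` (`decide`). -/
theorem perPairCheck_24 : perPairCheck 24 := by unfold perPairCheck; decide
/-- The per-pair check at `g = 25` (`decide`). -/
theorem perPairCheck_25 : perPairCheck 25 := by unfold perPairCheck; decide
/-- The per-pair check at `g = 26` (`decide`). -/
theorem perPairCheck_26 : perPairCheck 26 := by unfold perPairCheck; decide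
/-- The per-pair check at `g = 27` (`decide`). -/
theorem perPairCheck_27 : perPairCheck 27 := by unfold perPairCheck; decide
/-- The per-pair check at `g = 28` (`decide`). -/
theorem perPairCheck_28 : perPairCheck 28 := by unfold perPairCheck; decide
/-- The per-pair check at `g = 29` (`decide`). -/
theorem perPairCheck_29 : perPairCheck 29 := by unfold perPairCheck; decide
/-- The per-pair check at `g = 30` (`decide`). -/
theorem perPairCheck_30 : perPairCheck 30 := by unfold perPairCheck; decide
/-- The per-pair check at `g = 31` (`decide`). -/
theorem perPairCheck_31 : perPairCheck 31 := by unfold perPairCheck; decide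
/-- The per-pair check at `g = 32` (`decide`). -/
theorem perPairCheck_32 : perPairCheck 32 := by unfold perPairCheck; decide
/-- The per-pair check at `g = 33` (`decide`). -/
theorem perPairCheck_33 : perPairCheck 33 := by unfold perPairCheck; decide
/-- The per-pair check at `g = 34` (`decide`). -/
theorem perPairCheck_34 : perPairCheck 34 := by unfold perPairCheck; decide
/-- The per-pair check at `g = 35` (`decide`). -/
theorem perPairCheck_35 : perPairCheck 35 := by unfold perPairCheck; decide
/-- The per-pair check at `g = 36` (`decide`). -/
theorem perPairCheck_36 : perPairCheck 36 := by unfold perPairCheck; decide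
/-- The per-pair check at `g = 37` (`decide`). -/
theorem perPairCheck_37 : perPairCheck 37 := by unfold perPairCheck; decide
/-- The per-pair check at `g = 38` (`decide`). -/
theorem perPairCheck_38 : perPairCheck 38 := by unfold perPairCheck; decide
/-- The per-pair check at `g = 39` (`decide`). -/
theorem perPairCheck_39 : perPairCheck 39 := by unfold perPairCheck; decide
/-- The per-pair check at `g = 40` (`decide`). -/
theorem perPairCheck_40 : perPairCheck 40 := by unfold perPairCheck; decide
/-- The per-pair check at `g = 41` (`decide`). -/
theorem perPairCheck_41 : perPairCheck 41 := by unfold perPairCheck; decide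
/-- The per-pair check at `g = 42` (`decide`). -/
theorem perPairCheck_42 : perPairCheck 42 := by unfold perPairCheck; decide
/-- The per-pair check at `g = 43` (`decide`). -/
theorem perPairCheck_43 : perPairCheck 43 := by unfold perPairCheck; decide
/-- The per-pair check at `g = 44` (`decide`). -/
theorem perPairCheck_44 : perPairCheck 44 := by unfold perPairCheck; decide
/-- The per-pair check at `g = 45` (`decide`). -/
theorem perPairCheck_45 : perPairCheck 45 := by unfold perPairCheck; decide
/-- The per-pair check at `g = 46` (`decide`). -/
theorem perPairCheck_46 : perPairCheck 46 := by unfold perPairCheck; decide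
/-- The per-pair check at `g = 47` (`decide`). -/
theorem perPairCheck_47 : perPairCheck 47 := by unfold perPairCheck; decide
/-- The per-pair check at `g = 48` (`decide`). -/
theorem perPairCheck_48 : perPairCheck 48 := by unfold perPairCheck; decide
/-- The per-pair check at `g = 49` (`decide`). -/
theorem perPairCheck_49 : perPairCheck 49 := by unfold perPairCheck; decide
/-- The per-pair check at `g = 50` (`decide`). -/
theorem perPairCheck_50 : perPairCheck 50 := by unfold perPairCheck; decide
/-- The per-pair check at `g = 51` (`decide`). -/
theorem perPairCheck_51 : perPairCheck 51 := by unfold perPairCheck; decide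
/-- The per-pair check at `g = 52` (`decide`). -/
theorem perPairCheck_52 : perPairCheck 52 := by unfold perPairCheck; decide
/-- The per-pair check at `g = 53` (`decide`). -/
theorem perPairCheck_53 : perPairCheck 53 := by unfold perPairCheck; decide
/-- The per-pair check at `g = 54` (`decide`). -/
theorem perPairCheck_54 : perPairCheck 54 := by unfold perPairCheck; decide
/-- The per-pair check at `g = 55` (`decide`). -/
theorem perPairCheck_55 : perPairCheck 55 := by unfold perPairCheck; decide
/-- The per-pair check at `g = 56` (`decide`). -/
theorem perPairCheck_56 : perPairCheck 56 := by unfold perPairCheck; decide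
/-- The per-pair check at `g = 57` (`decide`). -/
theorem perPairCheck_57 : perPairCheck 57 := by unfold perPairCheck; decide
/-- The per-pair check at `g = 58` (`decide`). -/
theorem perPairCheck_58 : perPairCheck 58 := by unfold perPairCheck; decide
/-- The per-pair check at `g = 59` (`decide`). -/
theorem perPairCheck_59 : perPairCheck 59 := by unfold perPairCheck; decide
/-- The per-pair check at `g = 60` (`decide`). -/
theorem perPairCheck_60 : perPairCheck 60 := by unfold perPairCheck; decide
set_option maxRecDepth 20000 in
/-- The per-pair check at `g = 61` (`decide`). -/
theorem perPairCheck_61 : perPairCheck 61 := by unfold perPairCheck; decide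
set_option maxRecDepth 20000 in
/-- The per-pair check at `g = 62` (`decide`). -/
theorem perPairCheck_62 : perPairCheck 62 := by unfold perPairCheck; decide
set_option maxRecDepth 20000 in
/-- The per-pair check at `g = 63` (`decide`). -/
theorem perPairCheck_63 : perPairCheck 63 := by unfold perPairCheck; decide
set_option maxRecDepth 20000 in
/-- The per-pair check at `g = 64` (`decide`). -/
theorem perPairCheck_64 : perPairCheck 64 := by unfold perPairCheck; decide
set_option maxRecDepth 20000 in
/-- The per-pair check at `g = 65` (`decide`). -/
theorem perPairCheck_65 : perPairCheck 65 := by unfold perPairCheck; decide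
set_option maxRecDepth 20000 in
/-- The per-pair check at `g = 66` (`decide`). -/
theorem perPairCheck_66 : perPairCheck 66 := by unfold perPairCheck; decide
set_option maxRecDepth 20000 in
/-- The per-pair check at `g = 67` (`decide`). -/
theorem perPairCheck_67 : perPairCheck 67 := by unfold perPairCheck; decide
set_option maxRecDepth 20000 in
/-- The per-pair check at `g = 68` (`decide`). -/
theorem perPairCheck_68 : perPairCheck 68 := by unfold perPairCheck; decide
set_option maxRecDepth 20000 in
/-- The per-pair check at `g = 69` (`decide`). -/
theorem perPairCheck_69 : perPairCheck 69 := by unfold perPairCheck; decide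
set_option maxRecDepth 20000 in
/-- The per-pair check at `g = 70` (`decide`). -/
theorem perPairCheck_70 : perPairCheck 70 := by unfold perPairCheck; decide
set_option maxRecDepth 20000 in
/-- The per-pair check at `g = 71` (`decide`). -/
theorem perPairCheck_71 : perPairCheck 71 := by unfold perPairCheck; decide
set_option maxRecDepth 20000 in
/-- The per-pair check at `g = 72` (`decide`). -/
theorem perPairCheck_72 : perPairCheck 72 := by unfold perPairCheck; decide
set_option maxRecDepth 20000 in
/-- The per-pair check at `g = 73` (`decide`). -/
theorem perPairCheck_73 : perPairCheck 73 := by unfold perPairCheck; decide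
set_option maxRecDepth 20000 in
/-- The per-pair check at `g = 74` (`decide`). -/
theorem perPairCheck_74 : perPairCheck 74 := by unfold perPairCheck; decide
set_option maxRecDepth 20000 in
/-- The per-pair check at `g = 75` (`decide`). -/
theorem perPairCheck_75 : perPairCheck 75 := by unfold perPairCheck; decide
set_option maxRecDepth 20000 in
/-- The per-pair check at `g = 76` (`decide`). -/
theorem perPairCheck_76 : perPairCheck 76 := by unfold perPairCheck; decide
set_option maxRecDepth 20000 in
/-- The per-pair check at `g = 77` (`decide`). -/
theorem perPairCheck_77 : perPairCheck 77 := by unfold perPairCheck; decide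
set_option maxRecDepth 20000 in
/-- The per-pair check at `g = 78` (`decide`). -/
theorem perPairCheck_78 : perPairCheck 78 := by unfold perPairCheck; decide
set_option maxRecDepth 20000 in
/-- The per-pair check at `g = 79` (`decide`). -/
theorem perPairCheck_79 : perPairCheck 79 := by unfold perPairCheck; decide
set_option maxRecDepth 20000 in
/-- The per-pair check at `g = 80` (`decide`). -/
theorem perPairCheck_80 : perPairCheck 80 := by unfold perPairCheck; decide
set_option maxRecDepth 20000 in
/-- The per-pair check at `g = 81` (`decide`). -/
theorem perPairCheck_81 : perPairCheck 81 := by unfold perPairCheck; decide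
set_option maxRecDepth 20000 in
/-- The per-pair check at `g = 82` (`decide`). -/
theorem perPairCheck_82 : perPairCheck 82 := by unfold perPairCheck; decide
set_option maxRecDepth 20000 in
/-- The per-pair check at `g = 83` (`decide`). -/
theorem perPairCheck_83 : perPairCheck 83 := by unfold perPairCheck; decide
set_option maxRecDepth 20000 in
/-- The per-pair check at `g = 84` (`decide`). -/
theorem perPairCheck_84 : perPairCheck 84 := by unfold perPairCheck; decide
set_option maxRecDepth 20000 in
/-- The per-pair check at `g = 85` (`decide`). -/
theorem perPairCheck_85 : perPairCheck 85 := by unfold perPairCheck; decide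
set_option maxRecDepth 20000 in
/-- The per-pair check at `g = 86` (`decide`). -/
theorem perPairCheck_86 : perPairCheck 86 := by unfold perPairCheck; decide
set_option maxRecDepth 20000 in
/-- The per-pair check at `g = 87` (`decide`). -/
theorem perPairCheck_87 : perPairCheck 87 := by unfold perPairCheck; decide
set_option maxRecDepth 20000 in
/-- The per-pair check at `g = 88` (`decide`). -/
theorem perPairCheck_88 : perPairCheck 88 := by unfold perPairCheck; decide
set_option maxRecDepth 20000 in
/-- The per-pair check at `g = 89` (`decide`). -/
theorem perPairCheck_89 : perPairCheck 89 := by unfold perPairCheck; decide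
set_option maxRecDepth 20000 in
/-- The per-pair check at `g = 90` (`decide`). -/
theorem perPairCheck_90 : perPairCheck 90 := by unfold perPairCheck; decide
set_option maxRecDepth 20000 in
/-- The per-pair check at `g = 91` (`decide`). -/
theorem perPairCheck_91 : perPairCheck 91 := by unfold perPairCheck; decide
set_option maxRecDepth 20000 in
/-- The per-pair check at `g = 92` (`decide`). -/
theorem perPairCheck_92 : perPairCheck 92 := by unfold perPairCheck; decide
set_option maxRecDepth 20000 in
/-- The per-pair check at `g = 93` (`decide`). -/
theorem perPairCheck_93 : perPairCheck 93 := by unfold perPairCheck; decide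
set_option maxRecDepth 20000 in
/-- The per-pair check at `g = 94` (`decide`). -/
theorem perPairCheck_94 : perPairCheck 94 := by unfold perPairCheck; decide
set_option maxRecDepth 20000 in
/-- The per-pair check at `g = 95` (`decide`). -/
theorem perPairCheck_95 : perPairCheck 95 := by unfold perPairCheck; decide
set_option maxRecDepth 20000 in
/-- The per-pair check at `g = 96` (`decide`). -/
theorem perPairCheck_96 : perPairCheck 96 := by unfold perPairCheck; decide
set_option maxRecDepth 20000 in
/-- The per-pair check at `g = 97` (`decide`). -/
theorem perPairCheck_97 : perPairCheck 97 := by unfold perPairCheck; decide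
set_option maxRecDepth 20000 in
/-- The per-pair check at `g = 98` (`decide`). -/
theorem perPairCheck_98 : perPairCheck 98 := by unfold perPairCheck; decide
set_option maxRecDepth 20000 in
/-- The per-pair check at `g = 99` (`decide`). -/
theorem perPairCheck_99 : perPairCheck 99 := by unfold perPairCheck; decide
set_option maxRecDepth 20000 in
/-- The per-pair check at `g = 100` (`decide`). -/
theorem perPairCheck_100 : perPairCheck 100 := by unfold perPairCheck; decide

/-- `perPairCheck g` for every `11 ≤ g ≤ 100`. -/
theorem perPairCheck_of_range {g : ℕ} (hg : 11 ≤ g) (hg' : g ≤ 100) : perPairCheck g := by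
  interval_cases g
  exacts [perPairCheck_11, perPairCheck_12, perPairCheck_13, perPairCheck_14, perPairCheck_15, perPairCheck_16, perPairCheck_17, perPairCheck_18, perPairCheck_19, perPairCheck_20, perPairCheck_21, perPairCheck_22, perPairCheck_23, perPairCheck_24, perPairCheck_25, perPairCheck_26, perPairCheck_27, perPairCheck_28, perPairCheck_29, perPairCheck_30, perPairCheck_31, perPairCheck_32, perPairCheck_33, perPairCheck_34, perPairCheck_35, perPairCheck_36, perPairCheck_37, perPairCheck_38, perPairCheck_39, perPairCheck_40, perPairCheck_41, perPairCheck_42, perPairCheck_43, perPairCheck_44, perPairCheck_45, perPairCheck_46, perPairCheck_47, perPairCheck_48, perPairCheck_49, perPairCheck_50, perPairCheck_51, perPairCheck_52, perPairCheck_53, perPairCheck_54, perPairCheck_55, perPairCheck_56, perPairCheck_57, perPairCheck_58, perPairCheck_59, perPairCheck_60, perPairCheck_61, perPairCheck_62, perPairCheck_63, perPairCheck_64, perPairCheck_65, perPairCheck_66, perPairCheck_67, perPairCheck_68, perPairCheck_69, perPairCheck_70, perPairCheck_71, perPairCheck_72, perPairCheck_73, perPairCheck_74, perPairCheck_75, perPairCheck_76,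 perPairCheck_77, perPairCheck_78, perPairCheck_79, perPairCheck_80, perPairCheck_81, perPairCheck_82, perPairCheck_83, perPairCheck_84, perPairCheck_85, perPairCheck_86, perPairCheck_87, perPairCheck_88, perPairCheck_89, perPairCheck_90, perPairCheck_91, perPairCheck_92, perPairCheck_93, perPairCheck_94, perPairCheck_95, perPairCheck_96, perPairCheck_97, perPairCheck_98, perPairCheck_99, perPairCheck_100]

/-- **The per-pair inequality for `11 ≤ g ≤ 100`**, `3 ≤ p ≤ g − 3`, `2 ≤ m < p`. -/
theorem perPair3_of_range {g p m : ℕ} (hg : 11 ≤ g) (hg' : g ≤ 100) (hp : 3 ≤ p) (hpg : p + 3 ≤ g) (hm : 2 ≤ m)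
    (hmp : m < p) : PerPair3 g p m := by
  have hc := perPairCheck_of_range hg hg' p (by omega) m hmp
  rw [Bool.or_eq_true, Bool.not_eq_true', decide_eq_false_iff_not, decide_eq_true_eq] at hc
  have hN : PerPairN g p m := hc.resolve_left (not_not.2 ⟨hp, hpg, hm⟩)
  exact perPair3_of_perPairN (by omega) (by omega) hN

open Finset ThmH

variable {α : Type*} [DecidableEq α] {M : Matroid α} [M.Finite] {G : Finset α}

/-- **Theorem G₃ for `11 ≤ g ≤ 100`**: `0 ≤ J₃(G)` for every generic rank-`4` set `G ⊆ E` of a simple matroid with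
`11 ≤ |G| ≤ 100` points — no bound on the planes. -/
theorem J_three_nonneg_of_generic_of_table (hs : Simple M) (hG : G ⊆ gr M) (hr : M.eRk (G : Set α) = 4)
    (hgen : Generic M G) (hg : 11 ≤ G.card) (hg' : G.card ≤ 100) : 0 ≤ J M G 3 :=
  J_three_nonneg_of_generic_of_perPair hs hG hr hgen (by omega)
    (fun p m hp hpg hm hmp => perPair3_of_range hg hg' hp hpg hm hmp)

end PercRepro.SixFour
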